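import Summits.SmoothPoincare4.SmoothPoincare4.Theorems.WeakReductionDescentWeakReductionReducesStubLoopFromGenusThreeAux2
import Summits.SmoothPoincare4.SmoothPoincare4.Theorems.WeakReductionDescentWeakReductionReducesStubLoopFromGenusThreeAux3
import Literature.Topology.FourManifolds.CircleLoopNullhomotopy
import Literature.Topology.FourManifolds.HomotopyS4OrientableProofs
import Literature.Topology.FourManifolds.HomotopyS4CompactProofs
import Literature.Topology.FourManifolds.SPC4HandlesProofs
import Literature.AlgebraicTopology.FundamentalGroup.SpunFundamentalGroup
import Mathlib.AlgebraicTopology.FundamentalGroupoid.FundamentalGroup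
import Literature.Topology.FourManifolds.SmallTrisectionsChiZero
import Literature.Topology.FourManifolds.CircleSurgeryEuler
import Literature.Topology.FourManifolds.CircleSurgeryFundamentalGroup

/-!
# Crux `WeakReductionReduces` (stmt-SmoothPoincare4-17908), line `loop_dichotomy`, stub L₃ —
# auxiliary file 4: `stub_loopFromGenusThree` REDUCED to three named published facts

Stub L₃ (`stub_loopFromGenusThree`, support, theorem-shaped): a smooth homotopy `4`-sphere `M`
obtained by surgery (`Literature.Topology.FourManifolds.IsCircleSurgery`, either framing) on a
smoothly embedded loop `ℓ` in a closed smooth `X` carrying a GK-trisection of genus `g′ ≤ 3` is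
diffeomorphic to `S⁴` (Aranda–Zupan 2025 §5/§6 one rung up; Meier–Schirmer–Zupan 2016 Thm. 1.2;
Pao 1977).  This file proves

* `helper_loopFromGenusThree_of_facts` (registered helper): **L₃ VERBATIM from the three named
  facts below** — everything else in the printed proof sketch is proved, here or in the tree:
  - auxiliary file 2 (PROVED): `pathConnectedSpace_of_isGKTrisection` (a GK-trisected
    `4`-manifold is connected), `isOrientable_of_isCircleSurgery` (if the surgered `M` is
    orientable then so is `X`), and Gay–Kirby's Remark 2 / MSZ Remark 3.12 in general,
    `χ(X) = 2 + g − Σ kᵢ` (`relEuler_eq_of_isGKTrisection`);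
  - `exists_le_add_one_of_sum_eq` — `g ≤ 3 ∧ Σ k = g + 2 ⇒ ∃ i, kᵢ ≥ g − 1` (no `kᵢ ≤ g`
    needed);
  - auxiliary file 3 (PROVED): `helper_circleProdSphereThree_loop_homotopic_fibre` — a loop in
    `S¹ × S³` whose class normally generates `π₁` is homotopic to the fibre circle or its reverse
    (Hatcher Prop. 1.12 / Thm. 1.7 / Prop. 1.14, via the tree's winding homomorphism and degree);
  - the end-game `helper_loopSurgery_circleProdSphereThree_sphereFour` (auxiliary file 1): both
    surgeries on a loop of `X ≅ S¹ × S³` homotopic to the fibre circle give `S⁴`;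
  - from the tree: `χ(M) = 2`, compactness, simple connectivity and orientability of a smooth
    `M ≃ₕ S⁴` (`finRelHomology_of_homotopyEquiv_sphere_four`,
    `compactSpace_of_homotopyEquiv_sphere_four_holds`, `simplyConnectedSpace_sphere_four_holds`,
    `isOrientable_of_homotopyEquiv_sphere_four_holds`).
* The three NAMED FACTS (Literature named facts `def … : Prop`, nothing asserted; each a published
  statement in tree vocabulary — files `SmallTrisectionsChiZero.lean`, `CircleSurgeryEuler.lean`,
  `CircleSurgeryFundamentalGroup.lean` of `Literature/Topology/FourManifolds`, see their docstrings
  for the quotations):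
  - `msz_chiZero_circleProdSphereThree_gk` — MSZ16 Thm. 1.2 with GK Remark 2: a closed connected
    oriented `X` with a `(g; k)`-GK-trisection, some `kᵢ ≥ g − 1` and `Σ kᵢ = g + 2` (`χ = 0`),
    is `≅ S¹ × S³`;
  - `circleSurgery_relEuler_eq_add_two` — `χ(X_ℓ) = χ(X) + 2` for a circle surgery in dimension
    `4` (Kosinski VI (9.2)/(10.1), VII (1.1); Kirby I §2);
  - `circleSurgery_normalClosure_loop_eq_top` — Juhász 2023 Lemma 2.56 (Kosinski VII (1.2)):
    `π₁(X_ℓ) ≅ π₁(X)/⟨⟨ℓ⟩⟩`, in the form "`X_ℓ` simply connected ⇒ `[ℓ]` normally generates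
    `π₁(X)`";
  The third is provable with the tree's van Kampen machinery (kernel half,
  `VanKampen.fromPath_mem_of_homotopic_refl`, plus `π₁(X ∖ c) ≅ π₁(X)` in codimension `3` and the
  homotopy of the push-off to `c`), the second with the tree's Mayer–Vietoris Euler count
  (`finRelHomology_and_relEuler_of_isOpen_cover`); the first is the genuinely external input
  (Waldhausen, Laudenbach–Poénaru, Gabai/Gordon/Scharlemann surgery classification behind MSZ16).

## References

* J. Meier, T. Schirmer, A. Zupan, Proc. AMS 144 (2016), arXiv:1507.06561: Def. 1.1, Thm. 1.2,
  Remark 3.12. [MeierSchirmerZupan2016]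
* D. Gay, R. Kirby, Geom. Topol. 20 (2016): Def. 1, Remark 2. [GayKirby2016]
* R. Aranda, A. Zupan, arXiv:2503.04607 (2025): §2 p. 7 (`S_p`, `S′_p`, `π₁ = ℤ/p`), §5–§6.
  [ArandaZupan2025]
* P. S. Pao, Trans. AMS 227 (1977). [Pao1977]
* A. Juhász, *Differential and Low-Dimensional Topology* (2023), Lemma 2.56, Prop. 2.55.
  [Juhasz2023]
* A. Kosinski, *Differential Manifolds* (1993), VI §9–§10, VII §1. [Kosinski1993]
* R. Kirby, *The Topology of 4-Manifolds* (1989), Ch. I §2. [Kirby1989]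
* A. Hatcher, *Algebraic Topology* (2002), Prop. 1.12, Thm. 1.7, Prop. 1.14, §1.1. [HatcherAT2002]
* M. Hirsch, *Differential Topology* (1976), §4.4. [HirschDT1976]
-/

-- the registered namespace `Summit.SmoothPoincare4.SmoothPoincare4.Theorems…` repeats a component
set_option linter.dupNamespace false

noncomputable section

open scoped Manifold ContDiff Topology ContinuousMap
open Set Function
open Literature.Topology.FourManifolds
open Literature.AlgebraicTopology.SingularHomology Literature.AlgebraicTopology.Homotopy

namespace Summit.SmoothPoincare4.SmoothPoincare4.Theorems.WeakReductionReduces.LoopDichotomy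

universe u

/-! ### The arithmetic of the loop partner and the assembly of L₃ -/

/-- The loop partner `X`: a `(g; k)`-trisection with `g ≤ 3` and `Σ k = g + 2` (`χ(X) = 0`) has
some `kᵢ ≥ g − 1` — WITHOUT the a-priori bound `kᵢ ≤ g` (if all `kᵢ ≤ g − 2` then
`Σ k ≤ 3g − 6 < g + 2` for `g < 4`). [folklore] -/
theorem exists_le_add_one_of_sum_eq (g : ℕ) (k : Fin 3 → ℕ) (hg : g ≤ 3)
    (hsum : k 0 + k 1 + k 2 = g + 2) : ∃ i, g ≤ k i + 1 := by
  by_contra h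
  push Not at h
  have h0 := h 0
  have h1 := h 1
  have h2 := h 2
  omega

/-- **L₃ from the three named facts** (`stub_loopFromGenusThree` of line `loop_dichotomy`,
VERBATIM, conditional on `msz_chiZero_circleProdSphereThree_gk`,
`circleSurgery_relEuler_eq_add_two`, `circleSurgery_normalClosure_loop_eq_top`; D-0014).  A smooth homotopy `4`-sphere `M` obtained
by surgery on a smoothly embedded loop `ℓ` in a closed smooth `X` with a GK-trisection of genus
`g′ ≤ 3` is diffeomorphic to `S⁴`: `X` is compact and connected (trisection) and orientable
(`isOrientable_of_isCircleSurgery`, from the orientability of the homotopy sphere `M`, PROVED in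
tree); `χ(M) = 2` (PROVED in tree) and `χ(M) = χ(X) + 2` (fact) give `χ(X) = 0`, i.e.
`Σ k′ = g′ + 2` by the general Gay–Kirby Remark 2 (`relEuler_eq_of_isGKTrisection`, PROVED here),
whence some `k′ᵢ ≥ g′ − 1` (`exists_le_add_one_of_sum_eq`) and MSZ gives `Φ : X ≅ S¹ × S³`
(fact); `π₁(M) = 1` makes `[ℓ]` normally generate `π₁(X)` (fact), so `Φ ∘ ℓ` is homotopic to the
fibre circle or its reverse (`helper_circleProdSphereThree_loop_homotopic_fibre`, auxiliary file
3, PROVED); and the END-GAME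
`helper_loopSurgery_circleProdSphereThree_sphereFour` (auxiliary file 1, PROVED) concludes.
[cite: MeierSchirmerZupan2016, Thm. 1.2] [cite: ArandaZupan2025, §2 p. 7 and §5–§6]
[cite: Pao1977, Thm] -/
theorem helper_loopFromGenusThree_of_facts :
    Literature.Topology.FourManifolds.msz_chiZero_circleProdSphereThree_gk.{0} → Literature.Topology.FourManifolds.circleSurgery_relEuler_eq_add_two.{0} → Literature.Topology.FourManifolds.circleSurgery_normalClosure_loop_eq_top.{0} → ∀ (X : Type) [TopologicalSpace X] [T2Space X] [SecondCountableTopology X] [ChartedSpace (EuclideanSpace ℝ (Fin 4)) X] [IsManifold (𝓡 4) ((⊤ : ℕ∞) : WithTop ℕ∞) X] (g' : ℕ) (k' : Fin 3 → ℕ) (T' : Fin 3 → Set X), Literature.Topology.FourManifolds.IsGKTrisection X g' k' T' → g' ≤ 3 → ∀ (ℓ : (Metric.sphere (0 : EuclideanSpace ℝ (Fin 2)) 1) → X), Manifold.IsSmoothEmbedding (𝓡 1) (𝓡 4) ((⊤ : ℕ∞) : WithTop ℕ∞) ℓ → ∀ (M : Type) [TopologicalSpace M] [T2Space M] [SecondCountableTopology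 M] [ChartedSpace (EuclideanSpace ℝ (Fin 4)) M] [IsManifold (𝓡 4) ((⊤ : ℕ∞) : WithTop ℕ∞) M], (M ≃ₕ (Metric.sphere (0 : EuclideanSpace ℝ (Fin 5)) 1)) → Literature.Topology.FourManifolds.IsCircleSurgery (𝓡 4) (𝓡 4) X M ℓ → Nonempty (Diffeomorph (𝓡 4) (𝓡 4) M (Metric.sphere (0 : EuclideanSpace ℝ (Fin 5)) 1) ((⊤ : ℕ∞) : WithTop ℕ∞)) := by
  intro hMSZ hχ hπ X _ _ _ _ _ g' k' T' hT hg ℓ hℓ M _ _ _ _ _ e hsurg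
  haveI := Fact.mk (@finrank_euclideanSpace_fin ℝ _ 2)
  haveI := Fact.mk (@finrank_euclideanSpace_fin ℝ _ 4)
  haveI := Fact.mk (@finrank_euclideanSpace_fin ℝ _ 5)
  -- topology of `X` and `M`
  haveI : CompactSpace X := hT.compactSpace
  haveI : PathConnectedSpace X := pathConnectedSpace_of_isGKTrisection hT
  haveI : CompactSpace M := compactSpace_of_homotopyEquiv_sphere_four_holds M e
  haveI : SimplyConnectedSpace (Metric.sphere (0 : EuclideanSpace ℝ (Fin 5)) 1) :=
    simplyConnectedSpace_sphere_four_holds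
  haveI : SimplyConnectedSpace M := e.simplyConnectedSpace
  -- `X` is orientable (from `M`)
  obtain ⟨oX⟩ := isOrientable_of_isCircleSurgery
    (isOrientable_of_homotopyEquiv_sphere_four_holds M e) hsurg
  -- `χ(X) = 0`, i.e. `Σ k′ = g′ + 2`
  have hEM : relEuler ℤ ℤ M ∅ = 2 := (finRelHomology_of_homotopyEquiv_sphere_four e).2
  have hEX := relEuler_eq_of_isGKTrisection hT
  have hME := hχ X ℓ hℓ M hsurg
  have hsum : k' 0 + k' 1 + k' 2 = g' + 2 := by
    push_cast at hEX
    omega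
  -- MSZ: `X ≅ S¹ × S³`
  obtain ⟨Φ⟩ := hMSZ X oX g' k' T' hT (exists_le_add_one_of_sum_eq g' k' hg hsum) hsum
  -- `π₁`: the loop normally generates `π₁(X)`, hence `Φ ∘ ℓ` is the fibre circle up to homotopy
  let ℓc : C((Metric.sphere (0 : EuclideanSpace ℝ (Fin 2)) 1), X) := ⟨ℓ, hℓ.isEmbedding.continuous⟩
  let Φc : C(X, _) := ⟨Φ, Φ.continuous⟩
  have hN := hπ X ℓc hℓ M hsurg
  have hN' : Subgroup.normalClosure
      {(FundamentalGroup.fromPath (Path.Homotopic.Quotient.mk (Φc.comp ℓc).circleLoop) :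
        FundamentalGroup _ ((Φc.comp ℓc) (circlePoint 0)))} = ⊤ := by
    let ε := Homeomorph.fundamentalGroupCongr Φ.toHomeomorph (x := ℓ (circlePoint 0)) rfl
    have hsurj : Function.Surjective ε.toMonoidHom := ε.surjective
    have himg := congrArg (Subgroup.map ε.toMonoidHom) hN
    rw [Subgroup.map_normalClosure _ _ hsurj, Set.image_singleton,
      Subgroup.map_top_of_surjective _ hsurj] at himg
    convert himg using 3
    rw [MulEquiv.coe_toMonoidHom, Homeomorph.fundamentalGroupCongr_apply,
      Literature.AlgebraicTopology.FundamentalGroup.mapOfEq_fromPath]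
    rfl
  have hhom := helper_circleProdSphereThree_loop_homotopic_fibre (Φc.comp ℓc) hN'
  -- the end-game
  exact helper_loopSurgery_circleProdSphereThree_sphereFour X Φ ℓc hℓ hhom M hsurg

end Summit.SmoothPoincare4.SmoothPoincare4.Theorems.WeakReductionReduces.LoopDichotomy

end
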